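import Summits.HodgeConjecture.CorCM.Census.CyclicCharacterEvenZetaCertificate

/-!
# Cyclic characters, XXXII: EVEN KERNEL, toward `d = 0` — THE PARITY HALF: `K = [T_0] − [T_1] − Σ η` is a radical vector mod `2` when `d = 0`

COR-CM (cell `pub-hodgecm2`), count-neutral kernel combinatorics by the binder seat b09 (gen 43; lane CYCLIC-CHARACTER FIBRE LAW, part XXXII), on gen 32ʼs
half-parity law (`Census/HalfParityLaw.lean`: `mem_rad2_of_par2_eq_zero_of_hpi_eq_zero`, `card_block_add_halfRank_eq_fibreTwo_add_two_or`), gen 41ʼs fibre law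
for `d = 0` (`fibreTwo_add_two_eq_card_block`) and b23ʼs lifting lemmas (`Census/OddIndexGeneration.lean`) BY NAME.  Theorems only (no definition, no `decide`,
no certificate, no named fact, no `sorry`).  HONEST FRAMING: `HC_CM` is NOT proved, here or anywhere in the tree; nothing here is a period or a headline.

THE VECTOR `K = R(∅) = [T_0] − [T_1] − Σ_{s ∈ F_0} ([T_1^{(s)}] − [T_1])`: after parts XVI/XXV/XXXI the Hodge lattice is `L + ℤ[G]·K` for every lattice `L` with the
toward property containing the `ζ_s`, and `K·ν = K` for kernel elements `ν`.  Here: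
* §1 `par_fibreConst_eq_zero` : every BLOCK PARITY of `K` vanishes when `|F_0|` is even (the arc block and the block of the top flips of `T_1` each carry an even
  coefficient sum).
* §2 `halfRank_eq_zero_of_nonroot` : for `d = 0` (`φ₂ + 2 = β`, gen 41) the half-parity rank `t` is `0` (gen 32ʼs law `β + t ∈ {φ₂ + 1, φ₂ + 2}`), so the block
  parities separate the coinvariant fibre; hence `red_fibreConst_mem_rad2` : `red K ∈ rad2` for `d = 0`, `|F_0|` even.
* §3 `fibreConst_mem_of_nonroot` : lifting — `K = p + q + 2z` with `p ∈ ℤ⟨pairs⟩`, `q ∈ ℤ⟨f·Q⁻¹ − f : f a face⟩` and `z ∈ hodgeSpan`.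
Consequence (part XXXIII): modulo any `G`-stable `L ⊇ ℤ⟨pairs⟩` with `2·hodgeSpan ⊆ L`, `K` is a sum of `G`-coboundaries of Hodge vectors — the input of the
nilpotency argument that closes the `d = 0` law conditionally on `2·hodgeSpan ⊆ L` (`EVEN-KERNEL-ROADMAP.md`).

## References
* [Pohlmann1968] H. Pohlmann, Algebraic cycles on abelian varieties of complex multiplication type, Ann. of Math. 88 (1968), Thm 1.
-/

namespace Summit.HodgeConjecture.CorCM.Census.CyclicCharacter

open Finset
open Summit.HodgeConjecture.CorCM.Prior.AllgGroup.RfwfAllgGroup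
open Summit.HodgeConjecture.CorCM.Census.BlockParity
open Summit.HodgeConjecture.CorCM.Census.Coinvariant
open Summit.HodgeConjecture.CorCM.Census.TwistGeneration
open Summit.HodgeConjecture.CorCM.Census.Nondegenerate
open Summit.HodgeConjecture.CorCM.Census.BaseBlock
open Summit.HodgeConjecture.CorCM.Census.HalfParity
open Summit.HodgeConjecture.CorCM.Census.OddIndex

noncomputable section

variable {G : Type*} [Group G] [Fintype G] [DecidableEq G] {k : ℕ} {w : G → ZMod (2 ^ k)} {c : G}

/-! ## §1 The block parities of `K` vanish -/

/-- The top flips of `T_1` at bottom points lie in one block: `T_1^{(s)}·(s₀⁻¹s)⁻¹ = T_1^{(s₀)}`. [folklore] -/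
theorem blk_oflipCM_arcType_one_eq (hw : ∀ P Q : G, w (P * Q) = w P + w Q) (hk : 1 ≤ k) (hc2 : c * c = 1) (hwc : w c ≠ 0)
    {s s₀ : G} (hs : w s = 0) (hs₀ : w s₀ = 0) :
    blk c (oflipCM c hc2 s (arcType hw hk hc2 hwc 1)) = blk c (oflipCM c hc2 s₀ (arcType hw hk hc2 hwc 1)) := by
  have hQ : w (s₀⁻¹ * s) = 0 := by rw [hw, map_inv hw, hs, hs₀, neg_zero, zero_add]
  have e : rt c (s₀⁻¹ * s) (oflipCM c hc2 s (arcType hw hk hc2 hwc 1)) = oflipCM c hc2 s₀ (arcType hw hk hc2 hwc 1) := by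
    rw [rt_oflipCM, rt_arcType, hQ, sub_zero, mul_inv_rev, inv_inv, mul_inv_cancel_left]
  rw [← e, blk_rt]

/-- **The block parities of `K` vanish** when `|F_0|` is even. [folklore] -/
theorem par_fibreConst_eq_zero (hw : ∀ P Q : G, w (P * Q) = w P + w Q) (hk : 1 ≤ k) (hc2 : c * c = 1) (hwc : w c ≠ 0)
    (h1 : ∃ g₁ : G, w g₁ = 1) (hev : Even (univ.filter fun s : G => w s = 0).card) :
    par c (Finsupp.single (arcType hw hk hc2 hwc 0) (1 : ℤ) - Finsupp.single (arcType hw hk hc2 hwc 1) 1 -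
      ∑ s ∈ (univ.filter fun s : G => w s = 0),
        (Finsupp.single (oflipCM c hc2 s (arcType hw hk hc2 hwc 1)) (1 : ℤ) - Finsupp.single (arcType hw hk hc2 hwc 1) 1)) = 0 := by
  have h1F : (1 : G) ∈ univ.filter fun s : G => w s = 0 := mem_filter.mpr ⟨mem_univ _, map_one hw⟩
  have hsum : ∑ s ∈ (univ.filter fun s : G => w s = 0),
      par c (Finsupp.single (oflipCM c hc2 s (arcType hw hk hc2 hwc 1)) (1 : ℤ) - Finsupp.single (arcType hw hk hc2 hwc 1) 1) =
      (univ.filter fun s : G => w s = 0).card •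
        par c (Finsupp.single (oflipCM c hc2 1 (arcType hw hk hc2 hwc 1)) (1 : ℤ) - Finsupp.single (arcType hw hk hc2 hwc 1) 1) := by
    rw [← sum_const]
    refine sum_congr rfl fun s hs => ?_
    simp only [map_sub, par_single, blk_oflipCM_arcType_one_eq hw hk hc2 hwc (mem_filter.mp hs).2 (map_one hw)]
  rw [map_sub, map_sum, hsum]
  simp only [map_sub, par_single, blk_arcType_eq hw hk hc2 hwc h1 1, sub_self, zero_sub, neg_eq_zero]
  obtain ⟨r, hr⟩ := hev
  rw [hr, ← two_mul, mul_smul, two_smul]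
  ext B
  simp only [Pi.add_apply, Pi.smul_apply, Pi.zero_apply]
  exact CharTwo.add_self_eq_zero _

/-! ## §2 `d = 0`: no half-parity, so `red K ∈ rad2` -/

/-- **`d = 0` ⟹ `t(G, c) = 0`**: with `φ₂ + 2 = β` (gen 41ʼs fibre law for a non-root) gen 32ʼs law `β + t ∈ {φ₂ + 2, φ₂ + 1}` forces `t = 0`. [folklore] -/
theorem halfRank_eq_zero_of_nonroot (hw : ∀ P Q : G, w (P * Q) = w P + w Q) (hk2 : 2 ≤ k) (h1 : ∃ g₁ : G, w g₁ = 1)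
    (hc2 : c * c = 1) (hcen : ∀ x : G, x * c = c * x) (hwc : w c ≠ 0) (hnon : ∃ g : G, ¬ 2 ∣ (w g).val ∧ c ∉ Subgroup.zpowers g) :
    halfRank c hc2 = 0 := by
  have hβ := fibreTwo_add_two_eq_card_block hw hk2 h1 hc2 hcen hwc hnon
  rcases card_block_add_halfRank_eq_fibreTwo_add_two_or c hc2 (c_ne_one hw hwc) hcen with h | h <;> omega

/-- **`t = 0` ⟹ a Hodge vector mod `2` with vanishing block parities is radical.** [folklore] -/
theorem mem_rad2_of_par2_eq_zero_of_halfRank_eq_zero (hc2 : c * c = 1) (hc1 : c ≠ 1) (hcen : ∀ x : G, x * c = c * x)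
    (ht : halfRank c hc2 = 0) {x : CMF G c →₀ ZMod 2} (hx : x ∈ hodge2 c hc2) (hpx : par2 c x = 0) : x ∈ rad2 c hc2 := by
  refine mem_rad2_of_par2_eq_zero_of_hpi_eq_zero c hc2 hc1 hcen hx hpx ?_
  have hbot : (hodge2 c hc2 ⊓ LinearMap.ker (par2 c)).map (hpi c hc2) = ⊥ := Submodule.finrank_eq_zero.mp ht
  have hmem : hpi c hc2 x ∈ (hodge2 c hc2 ⊓ LinearMap.ker (par2 c)).map (hpi c hc2) :=
    Submodule.mem_map_of_mem ⟨hx, LinearMap.mem_ker.mpr hpx⟩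
  rw [hbot] at hmem
  exact (Submodule.mem_bot _).mp hmem

/-- **`ζ_s = ε_s + η_s` is a Hodge vector** (`w s = 0`): its type sum vanishes. [folklore] -/
theorem zeta_mem_hodgeSpan (hw : ∀ P Q : G, w (P * Q) = w P + w Q) (hk : 1 ≤ k) (hc2 : c * c = 1) (hcen : ∀ x : G, x * c = c * x) (hwc : w c ≠ 0)
    {s : G} (hs : w s = 0) :
    (Finsupp.single (oflipCM c hc2 s (arcType hw hk hc2 hwc 0)) (1 : ℤ) - Finsupp.single (arcType hw hk hc2 hwc 0) 1) +
      (Finsupp.single (oflipCM c hc2 s (arcType hw hk hc2 hwc 1)) (1 : ℤ) - Finsupp.single (arcType hw hk hc2 hwc 1) 1) ∈ hodgeSpan c hc2 := by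
  have hc1 : c ≠ 1 := c_ne_one hw hwc
  have hs0 : s ∈ (arcType hw hk hc2 hwc 0).1 := (mem_arcType_zero_and_notMem_one hw hk hc2 hwc hs).1
  have hcs1 : c * s ∈ (arcType hw hk hc2 hwc 1).1 := by
    have h := (mem_arcType_zero_and_notMem_one hw hk hc2 hwc hs).2
    by_contra h'
    exact h (((arcType hw hk hc2 hwc 1).2 s).mpr h')
  refine mem_hodgeSpan_of_forall_typeSum_eq c hc2 hc1 hcen (k := 0) fun x => ?_
  rw [← oflipCM_cmul c hc2 s (arcType hw hk hc2 hwc 1)]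
  simp only [map_add, map_sub, Pi.add_apply, Pi.sub_apply, typeSum_single]
  rw [indG_oflipCM_eq hc2 hc1 _ hs0, indG_oflipCM_eq hc2 hc1 _ hcs1, cmul_cmul c hc2]
  ring

/-- **`K = R(∅)` is a Hodge vector**: `K = (W2) − Σ_s ζ_s`. [folklore] -/
theorem fibreConst_mem_hodgeSpan (hw : ∀ P Q : G, w (P * Q) = w P + w Q) (hk : 1 ≤ k) (hc2 : c * c = 1) (hcen : ∀ x : G, x * c = c * x)
    (hwc : w c ≠ 0) :
    Finsupp.single (arcType hw hk hc2 hwc 0) (1 : ℤ) - Finsupp.single (arcType hw hk hc2 hwc 1) 1 -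
      ∑ s ∈ (univ.filter fun s : G => w s = 0),
        (Finsupp.single (oflipCM c hc2 s (arcType hw hk hc2 hwc 1)) (1 : ℤ) - Finsupp.single (arcType hw hk hc2 hwc 1) 1) ∈ hodgeSpan c hc2 := by
  -- (W2) is a Hodge vector (it lies in the span of the bottom-walk faces)
  have hW : (∑ s ∈ univ.filter (fun s => w s = 0), Finsupp.single (oflipCM c hc2 s (arcType hw hk hc2 hwc 0)) (1 : ℤ)) -
      Finsupp.single (arcType hw hk hc2 hwc 1) (1 : ℤ) -
        (((univ.filter fun s => w s = 0).card : ℤ) - 1) • Finsupp.single (arcType hw hk hc2 hwc 0) (1 : ℤ) ∈ hodgeSpan c hc2 := by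
    refine Submodule.mem_sup_left ((Submodule.span_mono ?_) (fibreSum_sub_mem_span_walkFaces hw hk hc2 hwc))
    rintro _ ⟨Φ', s, s', -, hs, hs', hss', rfl⟩
    refine ⟨Φ', s, s', ?_, rfl⟩
    rw [mem_orb]
    rintro (h | h)
    · exact hss' h.symm
    · exact ((arcType hw hk hc2 hwc 0).2 s).mp (mem_sdiff.mp hs).1 (h ▸ (mem_sdiff.mp hs').1)
  have hZ := Submodule.sum_mem (hodgeSpan c hc2) (t := univ.filter fun s : G => w s = 0)
    (f := fun s => (Finsupp.single (oflipCM c hc2 s (arcType hw hk hc2 hwc 0)) (1 : ℤ) - Finsupp.single (arcType hw hk hc2 hwc 0) 1) +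
      (Finsupp.single (oflipCM c hc2 s (arcType hw hk hc2 hwc 1)) (1 : ℤ) - Finsupp.single (arcType hw hk hc2 hwc 1) 1))
    fun s hs => zeta_mem_hodgeSpan hw hk hc2 hcen hwc (mem_filter.mp hs).2
  have h := Submodule.sub_mem _ hW hZ
  convert h using 1
  simp only [sum_add_distrib, sum_sub_distrib, sum_const, ← Nat.cast_smul_eq_nsmul ℤ, sub_smul, one_smul]
  abel

/-- **`red K ∈ rad2` for `d = 0` and `|F_0|` even.** [folklore] -/
theorem red_fibreConst_mem_rad2 (hw : ∀ P Q : G, w (P * Q) = w P + w Q) (hk : 1 ≤ k) (hk2 : 2 ≤ k) (hc2 : c * c = 1)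
    (hcen : ∀ x : G, x * c = c * x) (hwc : w c ≠ 0) (h1 : ∃ g₁ : G, w g₁ = 1)
    (hnon : ∃ g : G, ¬ 2 ∣ (w g).val ∧ c ∉ Subgroup.zpowers g) (hev : Even (univ.filter fun s : G => w s = 0).card) :
    red c (Finsupp.single (arcType hw hk hc2 hwc 0) (1 : ℤ) - Finsupp.single (arcType hw hk hc2 hwc 1) 1 -
      ∑ s ∈ (univ.filter fun s : G => w s = 0),
        (Finsupp.single (oflipCM c hc2 s (arcType hw hk hc2 hwc 1)) (1 : ℤ) - Finsupp.single (arcType hw hk hc2 hwc 1) 1)) ∈ rad2 c hc2 :=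
  mem_rad2_of_par2_eq_zero_of_halfRank_eq_zero hc2 (c_ne_one hw hwc) hcen (halfRank_eq_zero_of_nonroot hw hk2 h1 hc2 hcen hwc hnon)
    (red_mem_hodge2 c hc2 (fibreConst_mem_hodgeSpan hw hk hc2 hcen hwc))
    (by have h := par_fibreConst_eq_zero hw hk hc2 hwc h1 hev; rwa [← par2_red] at h)

/-! ## §3 Lifting: `K` is a pair vector plus coboundaries of faces plus twice a Hodge vector -/

/-- **Lifting a radical reduction**: a Hodge vector whose reduction mod `2` lies in `rad2 = pairs + coboundaries` is `p + q + 2z` with `p ∈ ℤ⟨pairs⟩`, `q` in the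
`ℤ`-span of the coboundaries `f·Q⁻¹ − f` of faces, and `z ∈ hodgeSpan` (saturation, b23ʼs lifting lemmas). [folklore] -/
theorem exists_lift_of_red_mem_rad2 (hc2 : c * c = 1) (hc1 : c ≠ 1) (hcen : ∀ x : G, x * c = c * x) {y : CMF G c →₀ ℤ}
    (hy : y ∈ hodgeSpan c hc2) (hr : red c y ∈ rad2 c hc2) :
    ∃ p ∈ Submodule.span ℤ (pairSet c), ∃ q ∈ Submodule.span ℤ {v : CMF G c →₀ ℤ | ∃ (Q : G) (f : CMF G c →₀ ℤ), f ∈ gfaceSet G c hc2 ∧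
      v = Finsupp.mapDomain (rt c Q) f - f}, ∃ z ∈ hodgeSpan c hc2, y = p + q + (2 : ℤ) • z := by
  obtain ⟨a, ha, b, hb, hab⟩ := Submodule.mem_sup.mp hr
  -- lift the pair part
  obtain ⟨p, hp, hpa⟩ := exists_mem_span_red_eq c ha
  -- the coboundaries mod 2 are reductions of integral coboundaries of faces
  have hsub : cobdry c hc2 ⊆ red c '' {v : CMF G c →₀ ℤ | ∃ (Q : G) (f : CMF G c →₀ ℤ), f ∈ gfaceSet G c hc2 ∧ v = Finsupp.mapDomain (rt c Q) f - f} := by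
    rintro _ ⟨Q, x, ⟨f, hf, rfl⟩, rfl⟩
    exact ⟨Finsupp.mapDomain (rt c Q) f - f, ⟨Q, f, hf, rfl⟩, by rw [map_sub, red_mapDomain]⟩
  have hb' : b ∈ Submodule.span (ZMod 2) (red c '' {v : CMF G c →₀ ℤ | ∃ (Q : G) (f : CMF G c →₀ ℤ), f ∈ gfaceSet G c hc2 ∧
      v = Finsupp.mapDomain (rt c Q) f - f}) := Submodule.span_mono hsub hb
  obtain ⟨q, hq, hqb⟩ := exists_mem_span_red_eq c hb'
  -- the remainder is even, and half of it is a Hodge vector by saturation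
  have hred : red c (y - p - q) = 0 := by rw [map_sub, map_sub, hpa, hqb, ← hab]; abel
  obtain ⟨z, hz⟩ := exists_eq_two_smul_of_red_eq_zero c hred
  have hpH : p ∈ hodgeSpan c hc2 := by
    refine (Submodule.span_le.mpr ?_) hp
    rintro _ ⟨Ψ, rfl⟩
    exact pair_mem_hodgeSpan c hc2 Ψ
  have hqH : q ∈ hodgeSpan c hc2 := by
    refine (Submodule.span_le.mpr ?_) hq
    rintro _ ⟨Q, f, hf, rfl⟩
    exact Submodule.sub_mem _ (mapDomain_rt_mem_hodgeSpan c hc2 hcen Q (gfaceSet_subset_hodgeSpan c hc2 hf)) (gfaceSet_subset_hodgeSpan c hc2 hf)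
  have hzH : z ∈ hodgeSpan c hc2 :=
    mem_hodgeSpan_of_smul_mem c hc2 hc1 hcen (n := 2) two_ne_zero (by rw [← hz]; exact Submodule.sub_mem _ (Submodule.sub_mem _ hy hpH) hqH)
  exact ⟨p, hp, q, hq, z, hzH, by rw [← hz]; abel⟩

/-- **THE PARITY HALF OF THE `d = 0` LAW.**  For `w ↠ ℤ/2ᵏ` (`k ≥ 2`), `w c ≠ 0`, `|F_0|` even and `d = 0` (some `g` with `w g` odd has `c ∉ ⟨g⟩`):
`K = [T_0] − [T_1] − Σ_{s ∈ F_0} ([T_1^{(s)}] − [T_1]) = p + q + 2z` with `p ∈ ℤ⟨pairs⟩`, `q ∈ ℤ⟨f·Q⁻¹ − f : f a face⟩`, `z ∈ hodgeSpan`. [folklore] -/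
theorem fibreConst_mem_of_nonroot (hw : ∀ P Q : G, w (P * Q) = w P + w Q) (hk : 1 ≤ k) (hk2 : 2 ≤ k) (hc2 : c * c = 1)
    (hcen : ∀ x : G, x * c = c * x) (hwc : w c ≠ 0) (h1 : ∃ g₁ : G, w g₁ = 1)
    (hnon : ∃ g : G, ¬ 2 ∣ (w g).val ∧ c ∉ Subgroup.zpowers g) (hev : Even (univ.filter fun s : G => w s = 0).card) :
    ∃ p ∈ Submodule.span ℤ (pairSet c), ∃ q ∈ Submodule.span ℤ {v : CMF G c →₀ ℤ | ∃ (Q : G) (f : CMF G c →₀ ℤ), f ∈ gfaceSet G c hc2 ∧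
      v = Finsupp.mapDomain (rt c Q) f - f}, ∃ z ∈ hodgeSpan c hc2,
      Finsupp.single (arcType hw hk hc2 hwc 0) (1 : ℤ) - Finsupp.single (arcType hw hk hc2 hwc 1) 1 -
        ∑ s ∈ (univ.filter fun s : G => w s = 0),
          (Finsupp.single (oflipCM c hc2 s (arcType hw hk hc2 hwc 1)) (1 : ℤ) - Finsupp.single (arcType hw hk hc2 hwc 1) 1) = p + q + (2 : ℤ) • z :=
  exists_lift_of_red_mem_rad2 hc2 (c_ne_one hw hwc) hcen (fibreConst_mem_hodgeSpan hw hk hc2 hcen hwc)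
    (red_fibreConst_mem_rad2 hw hk hk2 hc2 hcen hwc h1 hnon hev)

end

end Summit.HodgeConjecture.CorCM.Census.CyclicCharacter
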